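import Literature.Algebra.EuclideanLattices.DualGridQuality
import Literature.Algebra.EuclideanLattices.RegevDualQuery
import Literature.Algebra.EuclideanLattices.MRGapCVPEstimates
import Mathlib.Analysis.Normed.Module.Ball.Pointwise
import HarnessLib

/-!
# A `GapCVP′` instance read on the dual-grid lattice: the NO promise and eq. (15) in the scaled units of `Λ = Dg·L(B)*`

Topic `Algebra/EuclideanLattices` (family `pqc`). The machine of Micciancio–Regev 2007, Thm. 5.23 runs `W(B, S)`
on the INTEGER lattice `Λ = dualLat I.basis = Dg · L(B)*` (`Dg = det(B)²`, dual-grid model of the tree), so the witness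
analysis (`MRGapCVPBlocksD.toReal_witnessesD_not_acceptsZ_le`) is phrased for the dual pair `(L₀, Λ)` with
`L₀ = Λ* = Dg⁻¹ · L(B)`, the target `t′ = t/Dg` and the width `g = γ d/Dg`, whereas the promise of the instance
`((B, t), d)` speaks of `L(B)`, `t`, `γ d` (MR07 Def. 5.21: `λ₁(L(B)) > γd` and `dist(kt, L(B)) > γd` for odd `k`).
This file is the dictionary, everything PROVED:

* `dualLat_eq_smul` — `Λ = Dg · L(B)*` as submodules (`DualGridQuality.mem_dualLat_iff_smul_mem`);
  `dualLattice_dualLat_eq` — `Λ* = Dg⁻¹ · L(B)`;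
* `minNorm_dualLattice_dualLat` — `λ₁(Λ*) = λ₁(L(B))/Dg`; `infDist_dualLattice_dualLat` —
  `dist(x/Dg, Λ*) = dist(x, L(B))/Dg`;
* `no_promise_scaled` — **the NO promise in scaled units**: `γd < λ₁(L(B))` and `γd < dist(kt, L(B))` (odd `k`)
  give `g < λ₁(Λ*)` and `g < dist(k t′, Λ*)` with `g = γd/Dg`, `t′ = t/Dg`;
* `smoothingParameter_dualLat_lt` — **eq. (15) in scaled units**: `η_{2⁻ⁿ}(Λ) = Dg · η_{2⁻ⁿ}(L(B)*) < Dg √n/(γ d)`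
  (`DualGridQuality.smoothingParameter_dualLat`, MR07 Lemma 3.2), so that any Gaussian parameter
  `s ≥ 2√n Dg/(γd) = 2√n/g` has `2 η_{2⁻ⁿ}(Λ) ≤ s`.

## References

* D. Micciancio, O. Regev, *Worst-case to average-case reductions based on Gaussian measures*,
  SIAM J. Comput. 37 (2007) 267–302; authors' version, Def. 5.21 (p. 27), Lemma 3.2 (p. 11), Thm. 5.23
  (proof, eq. (15), p. 29).
* D. Micciancio, S. Goldwasser, *Complexity of Lattice Problems*, Kluwer 2002, Ch. 1 §1 (`L(B)* = L((B⁻¹)ᵀ)`,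
  scaling) [MicciancioGoldwasser2002].
-/

noncomputable section

open scoped Classical Pointwise Real

namespace Literature.Algebra.EuclideanLattices

open Module Submodule Matrix Finset GSInverse Metric MicciancioRegev2007

namespace DualGrid

variable {I : LatticeInstance}

/-! ### `Λ = Dg · L(B)*` and `Λ* = Dg⁻¹ · L(B)` -/

/-- **`Λ = Dg · L(B)*` as submodules.** [cite: MicciancioGoldwasser2002, Ch. 1 §1] -/
theorem dualLat_eq_smul (hI : I.IsNonsingular) :
    dualLat I.basis = ((Dg I.basis : ℤ) : ℝ) • dualLattice I.lattice := by
  have hD : ((Dg I.basis : ℤ) : ℝ) ≠ 0 := by exact_mod_cast (Dg_pos hI).ne'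
  ext x
  rw [Submodule.mem_smul_pointwise_iff_exists, mem_dualLat_iff_smul_mem hI]
  constructor
  · intro h
    exact ⟨_, h, by rw [smul_smul, mul_inv_cancel₀ hD, one_smul]⟩
  · rintro ⟨y, hy, rfl⟩
    rwa [smul_smul, inv_mul_cancel₀ hD, one_smul]

/-- **`Λ* = Dg⁻¹ · L(B)`.** [cite: MicciancioGoldwasser2002, Ch. 1 §1] -/
theorem dualLattice_dualLat_eq (hI : I.IsNonsingular) [IsZLattice ℝ I.lattice] :
    dualLattice (dualLat I.basis) = ((Dg I.basis : ℤ) : ℝ)⁻¹ • I.lattice := by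
  have hD : ((Dg I.basis : ℤ) : ℝ) ≠ 0 := by exact_mod_cast (Dg_pos hI).ne'
  rw [dualLat_eq_smul hI, dualLattice_pointwise_smul _ hD, dualLattice_dualLattice]

/-- **`λ₁(Λ*) = λ₁(L(B))/Dg`.** [cite: MicciancioGoldwasser2002, Ch. 1 §1] -/
theorem minNorm_dualLattice_dualLat (hI : I.IsNonsingular) [IsZLattice ℝ I.lattice] :
    minNorm (dualLattice (dualLat I.basis)) = ((Dg I.basis : ℤ) : ℝ)⁻¹ * minNorm I.lattice := by
  have hDp : (0 : ℝ) < ((Dg I.basis : ℤ) : ℝ) := by exact_mod_cast Dg_pos hI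
  rw [dualLattice_dualLat_eq hI, minNorm_pointwise_smul _ (inv_ne_zero hDp.ne'), abs_of_pos (inv_pos.2 hDp)]

/-- **`dist(x/Dg, Λ*) = dist(x, L(B))/Dg`.** [folklore] -/
theorem infDist_dualLattice_dualLat (hI : I.IsNonsingular) [IsZLattice ℝ I.lattice]
    (x : EuclideanSpace ℝ (Fin I.n)) :
    infDist (((Dg I.basis : ℤ) : ℝ)⁻¹ • x) ((dualLattice (dualLat I.basis) : Set (EuclideanSpace ℝ (Fin I.n)))) =
      ((Dg I.basis : ℤ) : ℝ)⁻¹ * infDist x ((I.lattice : Set (EuclideanSpace ℝ (Fin I.n)))) := by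
  have hDp : (0 : ℝ) < ((Dg I.basis : ℤ) : ℝ) := by exact_mod_cast Dg_pos hI
  rw [dualLattice_dualLat_eq hI, Submodule.coe_pointwise_smul, infDist_smul₀ (inv_ne_zero hDp.ne'),
    Real.norm_eq_abs, abs_of_pos (inv_pos.2 hDp)]

/-! ### The NO promise in scaled units -/

/-- **The `GapCVP′` NO promise read on `(Λ*, t/Dg)`**: from `γd < λ₁(L(B))` and `γd < dist(kt, L(B))` for every
odd `k`, with `g = γd/Dg` and `t′ = t/Dg`: `g < λ₁(Λ*)` and `g < dist(k t′, Λ*)` for every odd `k`.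
[cite: MicciancioRegev2007, Def. 5.21 (p. 27) and Thm. 5.23 (proof, NO case, p. 29)] -/
theorem no_promise_scaled (hI : I.IsNonsingular) [IsZLattice ℝ I.lattice]
    {γd : ℝ} (t : EuclideanSpace ℝ (Fin I.n))
    (hmin : γd < minNorm I.lattice)
    (hodd : ∀ k : ℤ, Odd k → γd < infDist ((k : ℝ) • t) ((I.lattice : Set (EuclideanSpace ℝ (Fin I.n))))) :
    γd / ((Dg I.basis : ℤ) : ℝ) < minNorm (dualLattice (dualLat I.basis)) ∧
      ∀ k : ℤ, Odd k → γd / ((Dg I.basis : ℤ) : ℝ) <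
        infDist ((k : ℝ) • (((Dg I.basis : ℤ) : ℝ)⁻¹ • t)) ((dualLattice (dualLat I.basis) : Set (EuclideanSpace ℝ (Fin I.n)))) := by
  have hDp : (0 : ℝ) < ((Dg I.basis : ℤ) : ℝ) := by exact_mod_cast Dg_pos hI
  refine ⟨?_, fun k hk => ?_⟩
  · rw [minNorm_dualLattice_dualLat hI, div_eq_inv_mul]
    exact mul_lt_mul_of_pos_left hmin (inv_pos.2 hDp)
  · rw [smul_comm, infDist_dualLattice_dualLat hI, div_eq_inv_mul]
    exact mul_lt_mul_of_pos_left (hodd k hk) (inv_pos.2 hDp)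

/-- `2√n/g = 2√n Dg/(γd)` for `g = γd/Dg`. [folklore] -/
theorem two_sqrt_div_scaled (hI : I.IsNonsingular) {γd : ℝ} (hγd : γd ≠ 0) :
    2 * Real.sqrt I.n / (γd / ((Dg I.basis : ℤ) : ℝ)) = 2 * Real.sqrt I.n * ((Dg I.basis : ℤ) : ℝ) / γd := by
  have hD : ((Dg I.basis : ℤ) : ℝ) ≠ 0 := by exact_mod_cast (Dg_pos hI).ne'
  field_simp

/-! ### Eq. (15) in scaled units -/

/-- **Eq. (15) for `Λ = Dg · L(B)*`**: on a lattice with `γd < λ₁(L(B))` (`n ≥ 1`),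
`η_{2⁻ⁿ}(Λ) < Dg √n/(γd)` (`η_{2⁻ⁿ}(Λ) = Dg η_{2⁻ⁿ}(L(B)*)`, MR07 Lemma 3.2: `η_{2⁻ⁿ}(L*) ≤ √n/λ₁(L)`); hence
every `s ≥ 2√n Dg/(γd)` has `2 η_{2⁻ⁿ}(Λ) ≤ s`.
[cite: MicciancioRegev2007, Thm. 5.23 (proof, eq. (15), p. 29) with Lemma 3.2 (p. 11)] -/
theorem smoothingParameter_dualLat_lt (hI : I.IsNonsingular) [IsZLattice ℝ I.lattice]
    [IsZLattice ℝ (dualLat I.basis)] (hn : 1 ≤ I.n) {γd : ℝ} (hγd : 0 < γd) (hmin : γd < minNorm I.lattice) :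
    smoothingParameter (dualLat I.basis) ((2⁻¹ : ℝ) ^ I.n) < ((Dg I.basis : ℤ) : ℝ) * Real.sqrt I.n / γd := by
  have hDp : (0 : ℝ) < ((Dg I.basis : ℤ) : ℝ) := by exact_mod_cast Dg_pos hI
  have hfin : finrank ℝ (EuclideanSpace ℝ (Fin I.n)) = I.n := finrank_euclideanSpace_fin
  have h := smoothingParameter_dual_lt I.lattice hγd hmin (by rw [hfin]; omega)
  rw [hfin] at h
  rw [smoothingParameter_dualLat hI, mul_div_assoc]
  exact mul_lt_mul_of_pos_left h hDp

/-- **Admissible Gaussian parameters**: `s ≥ 2√n Dg/(γd)` gives `2 η_{2⁻ⁿ}(Λ) ≤ s`. [cite: MicciancioRegev2007, Thm. 5.23 (proof, eq. (15), p. 29)] -/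
theorem two_mul_smoothingParameter_dualLat_le (hI : I.IsNonsingular) [IsZLattice ℝ I.lattice]
    [IsZLattice ℝ (dualLat I.basis)] (hn : 1 ≤ I.n) {γd s : ℝ} (hγd : 0 < γd) (hmin : γd < minNorm I.lattice)
    (hs : 2 * Real.sqrt I.n * ((Dg I.basis : ℤ) : ℝ) / γd ≤ s) :
    2 * smoothingParameter (dualLat I.basis) ((2⁻¹ : ℝ) ^ I.n) ≤ s := by
  have h := smoothingParameter_dualLat_lt hI hn hγd hmin
  have h2 : 2 * (((Dg I.basis : ℤ) : ℝ) * Real.sqrt I.n / γd) = 2 * Real.sqrt I.n * ((Dg I.basis : ℤ) : ℝ) / γd := by ring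
  linarith

end DualGrid

end Literature.Algebra.EuclideanLattices

end
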